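import Literature.NumberTheory.Automorphic.Liu2021.AppendixC.DefC1toC3
import Literature.NumberTheory.Automorphic.UnitaryGroupArithmeticLevels
import Mathlib.Analysis.SpecialFunctions.Log.Basic
import Mathlib.Topology.LocallyConstant.Basic
import HarnessLib

/-!
# Liu 2021, §5.2 — shared vocabulary: Definition 5.14 (relative regular semisimple pairs) and the test-function spaces
# `H_{K,ℂ}`, `𝒮(V(𝔸_E^∞))^K` of Definition 5.12 (print pp. 57, 72, 76–77) — SECTION CARPET, definitions only (REAL; no claim, no proof)

[Liu2021] = Yifeng Liu, *Fourier–Jacobi cycles and arithmetic relative trace formula* (with an appendix by Chao Li and Yihang Zhu),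
Cambridge J. Math. **9** (2021), no. 1, 1–147 = arXiv:2102.11518.  SOURCE READ: the print text held as
`paper:liu2021-fourier-jacobi-cycles-arithmetic-relative-trace-formula` (page file `pNNNN` = journal page `N`; «p. N Lk» = line `k` of that page
file).  This is the `<Section>Defs` file of the §5.2/§5.3 carpets `Sec52ArithmeticInvariantFunctionals` (items 5.12–5.19) and
`Sec53OrbitalDecomposition` (items 5.20–5.29), which both import it (squad TL «GO 500», deal TL-t13; split for size).  Everything here is a
REAL definition over the tree's unitary-group vocabulary of [Liu2021, App. C] (`AppendixC.HermSpace`: `V`, `V.n`, `V.basis`, `V.gram`,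
`U(V)(F) = V.rationalPoints ≤ GL_n(E)`, `U(V)(F') = V.unitaryGroup F'`, `G(𝔸^∞) = U(V)(𝔸_F^∞) = V.Gfin ≤ GL_n(𝔸_E^∞)`) and of the tree's
restricted-product description `U(V)(𝔸_F^∞) = ∏'_v U(V)(F_v)` (`UnitaryGroup.evalPlace`, `localPi`, `localPiEquiv`, `«local»`, `LocalRing E v =
∏_{w ∣ v} E_w`, `PlacesOver`).  Dedup (2026-09-02): the tree's «regular semisimple» declarations (`Literature/LinearAlgebra/Matrix/*RegularSemisimple*`)
concern single matrices with separable characteristic polynomial, not the relative pairs `(ξ, x)` of [Liu2021, Def. 5.14]; no tree declaration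
cites Def. 5.14.

READING R4 (coordinates, as in `AppendixC.DefC1toC3`): `V(E') = V ⊗_E E' = E'^{⊕n}` and `V(𝔸_E^∞) = (𝔸_E^∞)^{⊕n}` in the coordinates of `V.basis`,
on which `U(V) ≤ GL_n` acts by matrix × column vector.  READING L (local model): at a nonarchimedean place `v` of `F`, `E' = E ⊗_F F_v` is the
tree's `UnitaryGroup.LocalRing E v = ∏_{w ∣ v} E_w` and `U(V)(F_v)` the tree's `UnitaryGroup.«local» … v ≤ GL_n(E_v)` (`≃ localPi … v`, the `v`-th
factor of `U(V)(𝔸_F^∞)`).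

## INDEX (namespace `Literature.NumberTheory.Automorphic.Liu2021.Sec52Defs`)

**Def. 5.14** (p. 77 L24–42): (1) ↦ `IsRelRegularSemisimple`; (2) ↦ `relAct`, `RelPair`, `relOrbit`, `relOrbits` (`[U(V)(F') × V(E')]`), `relOrbitsRS`
(`[U(V)(F') × V(E')]_{rs}`); (3) ↦ `IsRegularlySupported`; (4) ↦ `IsRegularlySupportedAt` over `locGroup`/`LocPair`/`locPair`/`AwayPair`/`awayPair`
(READING L) — generic over a subgroup `U ≤ GL_n(R)` so that §5.3 instantiates it at `U(V̄)(F) ≤ GL_n(E)` as well.  Vocabulary of Def. 5.12 and of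
§4.3 p. 57 / §5.1 p. 72: `VAd` (`V(𝔸_E^∞)`), `vecAct` (the action «via the variable»), `formCoord` (`( , )_V` in coordinates), `heckeAlgebra`
(`H_{K,ℂ} = C_c^∞(K\G(𝔸_F^∞)/K, ℂ)`), `schwartz`, `schwartzInv` (`𝒮(V(𝔸_E^∞))^K`), `tensorFn` («`f ⊗ φ`»), `levelAt` (`K_v`), `IsDecomposable`
(«`K = ∏_v K_v`», p. 57 L8–10), `trFQ`/`expWeight` (the weight `e^{−2π·Tr_{F/ℚ} T}` of the formal generating series, p. 72).  Nothing is asserted.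

## References
* [Liu2021] Def. 5.14 p. 77; Def. 5.12 p. 76; §4.3 p. 57 (level subgroups, `H_{K,R}`); §5.1 p. 72 (`𝒮(V(𝔸_E^∞))`, the weights).
-/

noncomputable section

open CategoryTheory
open scoped TensorProduct Matrix
open NumberField IsDedekindDomain
open Literature.NumberTheory.Automorphic.Liu2021.AppendixC (conj HermSpace)

namespace Literature.NumberTheory.Automorphic.Liu2021.Sec52Defs

/-! ## Definition 5.14 (p. 77) — relative regular semisimple pairs, orbits, regularly supported functions
(REAL, generic linear algebra in coordinates) -/

section RelPairs

variable {R : Type} [CommRing R] {n : ℕ}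

/-- **[Liu2021, Definition 5.14 (1)] in coordinates** (p. 77 L26–29): «Consider a field extension `F'/F` and put `E' := E ⊗_F F'`.
(1) We say that a pair of elements `(ξ, x) ∈ U(V)(F') × V(E')` is *regular semisimple* if the vectors `{ξ^i x | i = 0, …, n − 1}`
span the `E'`-module `V(E')`.»  Typed for `ξ ∈ GL_n(R)`, `x ∈ R^n` over any commutative ring `R` (here `R = E'` and
`V(E') = E'^{⊕n}` in the coordinates of a basis of `V`, as in `AppendixC.HermSpace.unitaryGroup`, READING R4 there): the
`R`-span of `{ξ^i x | i < n}` is everything. REAL. [cite: Liu2021, Def. 5.14 (1) (p. 77)] -/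
def IsRelRegularSemisimple (ξ : GL (Fin n) R) (x : Fin n → R) : Prop :=
  Submodule.span R (Set.range fun i : Fin n => ((ξ : Matrix (Fin n) (Fin n) R) ^ (i : ℕ)) *ᵥ x) = ⊤

/-- **[Liu2021, Definition 5.14 (2)], the action** (p. 77 L30–31): «The group `U(V)(F')` acts on `U(V)(F') × V(E')` via the formula
`(ξ, x)g = (g^{−1} ξ g, g^{−1} x)`.»  Typed in coordinates for `g, ξ ∈ GL_n(R)`, `x ∈ R^n`. REAL.
[cite: Liu2021, Def. 5.14 (2) (p. 77)] -/
def relAct (g : GL (Fin n) R) (p : GL (Fin n) R × (Fin n → R)) : GL (Fin n) R × (Fin n → R) :=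
  (g⁻¹ * p.1 * g, ((g⁻¹ : GL (Fin n) R) : Matrix (Fin n) (Fin n) R) *ᵥ p.2)

variable (U : Subgroup (GL (Fin n) R))

/-- The set `U × V(E')` of pairs `(ξ, x)` for a subgroup `U ≤ GL_n(R)` (`U = U(V)(F')`, `R = E'`). REAL.
[cite: Liu2021, Def. 5.14 (p. 77)] -/
abbrev RelPair : Type := U × (Fin n → R)

/-- The `U`-orbit of a pair `(ξ, x)` under `(ξ, x)g = (g^{−1} ξ g, g^{−1} x)` (Def. 5.14 (2)). REAL.
[cite: Liu2021, Def. 5.14 (2) (p. 77)] -/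
def relOrbit (p : RelPair U) : Set (RelPair U) :=
  {p' | ∃ g : U, relAct (g : GL (Fin n) R) ((p.1 : GL (Fin n) R), p.2) = ((p'.1 : GL (Fin n) R), p'.2)}

/-- **[Liu2021, Definition 5.14 (2)]**: «Denote by `[U(V)(F') × V(E')]` the orbits of `U(V)(F') × V(E')` under the above action»
— the set of `U`-orbits. REAL. [cite: Liu2021, Def. 5.14 (2) (p. 77)] -/
def relOrbits : Set (Set (RelPair U)) := Set.range (relOrbit U)

/-- **[Liu2021, Definition 5.14 (2)]**: «and by `[U(V)(F') × V(E')]_{rs}` the subset of regular semisimple orbits» (the action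
«preserves regular semisimple pairs», L31: an orbit is regular semisimple iff all (equivalently one) of its members are).
REAL. [cite: Liu2021, Def. 5.14 (2) (p. 77)] -/
def relOrbitsRS : Set (Set (RelPair U)) :=
  {O ∈ relOrbits U | ∀ p ∈ O, IsRelRegularSemisimple (p.1 : GL (Fin n) R) p.2}

/-- **[Liu2021, Definition 5.14 (3)]** (p. 77 L35–36): «We say that a function on `U(V)(F') × V(E')` is *regularly supported* if
its support consists of only regular semisimple pairs.» REAL (`Function.support`). [cite: Liu2021, Def. 5.14 (3) (p. 77)] -/
def IsRegularlySupported (Φ : RelPair U → ℂ) : Prop :=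
  Function.support Φ ⊆ {p | IsRelRegularSemisimple (p.1 : GL (Fin n) R) p.2}

end RelPairs

/-! ## The standing data of §5 (p. 57, p. 68) in the tree's vocabulary; test functions `H_{K,ℂ}`, `𝒮(V(𝔸_E^∞))^K` (REAL) -/

section TestFunctions

variable {F E : Type} [Field F] [NumberField F] [IsTotallyReal F] [Field E] [NumberField E] [Algebra F E]
  [IsTotallyComplex E] [Algebra.IsQuadraticExtension F E]
variable (V : HermSpace F E)

/-- `V(𝔸_E^∞) = V ⊗_E 𝔸_E^∞ = (𝔸_E^∞)^{⊕n}` in the coordinates of `V.basis` (the coordinates in which `G(𝔸^∞) = V.Gfin ≤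
GL_n(𝔸_E^∞)`, `AppendixC.HermSpace.Gfin`). REAL. [cite: Liu2021, §5.1 (p. 72)] -/
abbrev VAd : Type := Fin V.n → FiniteAdeleRing (𝓞 E) E

/-- «`𝒮(V(𝔸_E^∞))` … admits an action by `G(𝔸^∞)` via the variable» (p. 72 L5–6): the underlying action `x ↦ g x` of
`G(𝔸^∞) ≤ GL_n(𝔸_E^∞)` on `V(𝔸_E^∞) = (𝔸_E^∞)^{⊕n}` (matrix × column vector). REAL. [cite: Liu2021, §5.1 (p. 72)] -/
def vecAct (g : V.Gfin) (x : VAd V) : VAd V :=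
  ((g : GL (Fin V.n) (FiniteAdeleRing (𝓞 E) E)) : Matrix (Fin V.n) (Fin V.n) (FiniteAdeleRing (𝓞 E) E)) *ᵥ x

/-- The hermitian form of `V` in the coordinates of `V.basis`: `(x, y)_V` for coordinate vectors `x, y ∈ E^{⊕n}`. REAL.
[cite: Liu2021, App. C l. 4558] -/
def formCoord (x y : Fin V.n → E) : E := V.form (V.basis.equivFun.symm x) (V.basis.equivFun.symm y)

/-- **`H_{K,ℂ} := C_c^∞(K\G(𝔸_F^∞)/K, ℂ)`** (p. 57 L26–29: «For a level subgroup `K ⊆ G(𝔸_F^∞)`, we have the Hecke (sub)algebra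
`H_{K,R} := C_c^∞(K\G(𝔸_F^∞)/K, R)`»; `H_R := C_c^∞(G(𝔸_F^∞), R)` the full Hecke algebra, L14–16), with `R = ℂ`: the set of locally
constant (= smooth), compactly supported, bi-`K`-invariant functions `G(𝔸^∞) → ℂ`.  The convolution product («with respect to the
canonical volume (Definition 4.22(3))», L16–17) is not typed here. REAL. [cite: Liu2021, §4.3 (p. 57)] -/
def heckeAlgebra (K : Subgroup V.Gfin) : Set (V.Gfin → ℂ) :=
  {f | IsLocallyConstant f ∧ HasCompactSupport f ∧ ∀ k₁ ∈ K, ∀ k₂ ∈ K, ∀ g : V.Gfin, f (k₁ * g * k₂) = f g}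

/-- **`𝒮(V(𝔸_E^∞))`** (p. 72 L5–6: «the space of complex valued Schwartz functions on `V(𝔸_E^∞)`»): locally constant compactly
supported functions `V(𝔸_E^∞) → ℂ`. REAL. [cite: Liu2021, §5.1 (p. 72)] -/
def schwartz : Set (VAd V → ℂ) := {φ | IsLocallyConstant φ ∧ HasCompactSupport φ}

/-- **`𝒮(V(𝔸_E^∞))^K`** (p. 76 L20–21: «`φ ∈ 𝒮(V(𝔸_E^∞))^K`»): the `K`-invariants for the action «via the variable». REAL.
[cite: Liu2021, Def. 5.12 (p. 76)] -/
def schwartzInv (K : Subgroup V.Gfin) : Set (VAd V → ℂ) :=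
  {φ ∈ schwartz V | ∀ k ∈ K, ∀ x : VAd V, φ (vecAct V k x) = φ x}

/-- `f ⊗ φ` «as a function on `U(V)(𝔸_F^∞) × V(𝔸_E^∞)`» (Def. 5.14 (4), Prop. 5.15 (2): «if `f ⊗ φ` is regularly supported at
some nonarchimedean place `v`»): `(g, x) ↦ f(g) φ(x)`. REAL. [cite: Liu2021, Prop. 5.15 (2) (p. 77)] -/
def tensorFn (f : V.Gfin → ℂ) (φ : VAd V → ℂ) : V.Gfin × VAd V → ℂ := fun a => f a.1 * φ a.2

/-- **`U(V)(F_v)`** for a nonarchimedean place `v` of `F`, as the subgroup of `GL_n(E_v)`, `E_v := E ⊗_F F_v = ∏_{w ∣ v} E_w` (the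
tree's `UnitaryGroup.LocalRing E v` and `UnitaryGroup.«local»`; READING L: this is `U(V)(F')`, `V(E') = E'^{⊕n}` of Def. 5.14 at
`F' = F_v`, written in the tree's model `E ⊗_F F_v = ∏_{w ∣ v} E_w` of `E'`). REAL. [cite: Liu2021, Def. 5.14 (4) (p. 77)] -/
abbrev locGroup (v : HeightOneSpectrum (𝓞 F)) : Subgroup (GL (Fin V.n) (UnitaryGroup.LocalRing E v)) :=
  UnitaryGroup.«local» E (conj F E) V.n V.gram v

/-- Local pairs `U(V)(F_v) × V(E_v)` (Def. 5.14 with `F' = F_v`, READING L). REAL. [cite: Liu2021, Def. 5.14 (4) (p. 77)] -/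
abbrev LocPair (v : HeightOneSpectrum (𝓞 F)) : Type := RelPair (locGroup V v)

/-- The `v`-component `(g_v, x_v) ∈ U(V)(F_v) × V(E_v)` of `(g, x) ∈ U(V)(𝔸_F^∞) × V(𝔸_E^∞)`: `g_v` through the tree's
`UnitaryGroup.evalPlace v` (restricted-product factor `U(V)(𝔸_F^∞) = ∏'_v U(V)(F_v)`) and `localPiEquiv`; `x_v = (x_w)_{w ∣ v}`.
REAL. [cite: Liu2021, Def. 5.14 (4) (p. 77)] -/
def locPair (v : HeightOneSpectrum (𝓞 F)) (a : V.Gfin × VAd V) : LocPair V v :=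
  (UnitaryGroup.localPiEquiv E (conj F E) V.n V.gram v (UnitaryGroup.evalPlace F E (conj F E) V.n V.gram v a.1),
    fun i w => (a.2 i) w.1)

/-- The away-from-`v` components of a pair: `((g_u)_{u ≠ v}, (x_w)_{w ∤ v})`, `g_u ∈ U(V)(F_u)` (tree `UnitaryGroup.localPi u`),
`x_w ∈ E_w^{⊕n}` — the coordinates of `U(V)(𝔸_F^{∞,v}) × V(𝔸_E^{∞,v})`. REAL. [cite: Liu2021, Def. 5.14 (4) (p. 77)] -/
abbrev AwayPair (v : HeightOneSpectrum (𝓞 F)) : Type :=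
  ((u : {u : HeightOneSpectrum (𝓞 F) // u ≠ v}) → UnitaryGroup.localPi E (conj F E) V.n V.gram u.1) ×
    ((w : {w : HeightOneSpectrum (𝓞 E) // w.under (𝓞 F) ≠ v}) → Fin V.n → w.1.adicCompletion E)

/-- The away-from-`v` component of `(g, x) ∈ U(V)(𝔸_F^∞) × V(𝔸_E^∞)`. REAL. [cite: Liu2021, Def. 5.14 (4) (p. 77)] -/
def awayPair (v : HeightOneSpectrum (𝓞 F)) (a : V.Gfin × VAd V) : AwayPair V v :=
  (fun u => UnitaryGroup.evalPlace F E (conj F E) V.n V.gram u.1 a.1, fun w i => (a.2 i) w.1)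

/-- **[Liu2021, Definition 5.14 (4)]** (p. 77 L38–42): «We say that a function `F` on `U(V)(𝔸_F^∞) × V(𝔸_E^∞)` is *regularly supported
at* some nonarchimedean place `v` of `F` if we can write `F = F_v ⊗ F^v` in which `F_v`, as a function on `U(V)(F_v) × V(E_v)`, is
regularly supported in the sense of (3).»  Typed: there are `F_v : U(V)(F_v) × V(E_v) → ℂ` and `F^v` on the away-from-`v`
components with `F(g, x) = F_v(g_v, x_v) · F^v(g^v, x^v)` for all `(g, x)`, and `F_v` is regularly supported (READING L). REAL.
[cite: Liu2021, Def. 5.14 (4) (p. 77)] -/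
def IsRegularlySupportedAt (v : HeightOneSpectrum (𝓞 F)) (Fn : V.Gfin × VAd V → ℂ) : Prop :=
  ∃ (Fv : LocPair V v → ℂ) (Fav : AwayPair V v → ℂ),
    (∀ a, Fn a = Fv (locPair V v a) * Fav (awayPair V v a)) ∧ IsRegularlySupported (locGroup V v) Fv

/-- The `v`-component `K_v ≤ U(V)(F_v)` of a subgroup `K ≤ G(𝔸^∞)`: the image of `K` under `evalPlace v` (tree model
`UnitaryGroup.localPi v ≤ ∏_{w ∣ v} GL_n(E_w)` of `U(V)(F_v)`). REAL. [cite: Liu2021, §4.3 (p. 57)] -/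
def levelAt (K : Subgroup V.Gfin) (v : HeightOneSpectrum (𝓞 F)) :
    Subgroup (UnitaryGroup.localPi E (conj F E) V.n V.gram v) :=
  K.map (UnitaryGroup.evalPlace F E (conj F E) V.n V.gram v)

/-- «decomposable, that is, `K` can be written as `∏_v K_v` when `v` runs over all nonarchimedean places of `F`» (p. 57 L8–10), inside
`U(V)(𝔸_F^∞) = ∏'_v U(V)(F_v)`: `g ∈ K` iff `g_v ∈ K_v` for every `v`, `K_v` the `v`-component of `K`. REAL.
[cite: Liu2021, §4.3 (p. 57)] -/
def IsDecomposable (K : Subgroup V.Gfin) : Prop :=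
  ∀ g : V.Gfin, g ∈ K ↔ ∀ v : HeightOneSpectrum (𝓞 F), UnitaryGroup.evalPlace F E (conj F E) V.n V.gram v g ∈ levelAt V K v

/-- The index weight `T ↦ Tr_{F/ℚ} T` of the formal generating series of §5 (p. 72: «`e^{−2π·Tr_{F/ℚ}(x,x)_V}`»; p. 84, p. 86), for
`T = (x, x)_V ∈ F` read inside `E`: `Tr_{F/ℚ} T = Tr_{E/ℚ}(T)/2` for `T ∈ F` (`[E : F] = 2`). REAL (READING FS below).
[cite: Liu2021, §5.1 (p. 72)] -/
def trFQ (T : E) : ℚ := Algebra.trace ℚ E T / 2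

/-- The printed weight `e^{−2π·Tr_{F/ℚ} T}` of the index `T` (p. 72, p. 84 L47, p. 86 L20). REAL. [cite: Liu2021, §5.1 (p. 72)] -/
def expWeight (T : E) : ℂ := Complex.exp (-(2 * Real.pi * (trFQ T : ℝ) : ℝ))

end TestFunctions

end Literature.NumberTheory.Automorphic.Liu2021.Sec52Defs

end
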